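import Summits.Ventures.Crystal3D.Theorems.StickyWulffConstantCoaxialWallLawPayerTwinCellTopNm
import Summits.Ventures.Crystal3D.Theorems.StickyWulffConstantCoaxialWallLawReducedWordRigidity
import Summits.Ventures.Crystal3D.Theorems.StickyWulffConstantCoaxialWallLawEndRowDefsA
import Summits.Ventures.Crystal3D.Theorems.StickyWulffConstantCoaxialWallLawPayerEndPairsMultiGen
import HarnessLib

/-!
# The cell mirror `z ↦ c₂ − z`: pulling a TYPED end-pair export of the mirrored cell back to the cell (F_layer OneFcc, transport file)

HONEST FRAMING. Venture `Summits/Ventures/Crystal3D` (cell `crystal3d-full`); helper `--supports` the crux `CoaxialWallLaw`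
(stmt-Ventures-19481, REGISTERED line `WallLedgerF`) in its role as owner of lane T's debt T-F2 / F_layer, OneFcc half (cf-p1 (civ)/(cxx)
«OneFcc = TWO FAMILIES»; memo HOME/wall-19481-p1/g16/TWO-FAMILY-LEDGER-g16.md).  Census-free, plate-free, standard axioms; nothing about
the crux is claimed; F-C1 not moved.

WHY.  In a OneFcc cell ONE of the two word families is always sourced at the TOP plate (case fcc-below: the faulted plate's opposite tree;
case faulted-below: the fcc plate's own tree), while every census file is written for a BOTTOM source.  The top-sourced family is therefore run
in the MIRRORED cell `M(X)`, `M p = basalMirror p + c` (`basalMirror c = −c`, e.g. `c = h·e₃`: `M p = (p₀, p₁, h − p₂)`, an involutive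
isometry swapping the two clamps), and its typed export is pulled back here — the plate-agnostic core of 19481-p1 g8's `…PayerTwinCellTopNm`
(which did this for the fcc twin cell), now for ANY export of the typed shape of `wordNet_barlow_endPairs_oneFcc` (p698172) /
`wordNet_barlow_endPairs_oneFccB` (this gen): pairs in the window, two payers, and a witness `∃ r ∈ inPlaneRoots G 1, ∃ κ, WFChain r κ ∧
predecessor ∧ IsEndMove` over a root frame `G`.

**`endPairs_pullback_mirror`** — if the root frame of the mirrored export is `G = (H ≫ L) ≫ basalMirror` (`H` = the half-turn about `e₃`),
the pulled-back pairs `(M b, M q)` are, in the ORIGINAL configuration `X`: balls at distance `1` in the reflected window, with two payers (degrees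
are `M`-invariant), each witnessed (i) by an ADMISSIBLE CLASS of the top system `S₂ = ⟨H ≫ L, inPlaneRoots (H ≫ L) (−1)⟩` of the twin row of
record `EndRowTwinHalfTurnA … L` together with the predecessor clause and `IsEndMove` (`isEndMove_transport`), and (ii) in the SHAPE form over
the bottom frame `L` that the disjointness LEMMA X″ `word_target_ne_twoPlate_shape₂` consumes: root `r ∈ inPlaneRoots L 1`, chain `κ` of unit
model menu letters oblique to `r` with `κ ++ [e₃]` a chain, direction `d = Fw_L (κ ++ [e₃]) ((−1)^{|κ|+1} r)`, and `M b = M q + d` or the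
cross shape — because `basalMirror ∘ Fw_G κ = −Fw_L (κ ++ [e₃]) = Fw_{H≫L} κ` letter by letter.
WHAT THIS IS NOT: no census, no row, no plates; F-C1 not moved.
-/

noncomputable section

namespace Summit.Ventures.Crystal3D.Theorems

open Summit.Ventures.Crystal3D Finset
open Literature.MathematicalPhysics.StatisticalMechanics (basalMirror basalMirror_apply_coord basalMirror_basalMirror)
open scoped InnerProductSpace

/-- `Fw` of a plate system on an appended basal letter: `Fw_L (κ ++ [e₃]) = Fw_{M_{e₃} ≫ L} κ`. -/
theorem PlateSystem.fw_append_e₃ (L : EuclideanSpace ℝ (Fin 3) ≃ₗᵢ[ℝ] EuclideanSpace ℝ (Fin 3))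
    (RT RT' : Finset (EuclideanSpace ℝ (Fin 3))) (κ : List (EuclideanSpace ℝ (Fin 3))) :
    (⟨L, RT⟩ : PlateSystem).Fw (κ ++ [EuclideanSpace.single (2 : Fin 3) (1 : ℝ)]) =
      (⟨basalMirror.trans L, RT'⟩ : PlateSystem).Fw κ := by
  induction κ with
  | nil => rfl
  | cons μ κ ih => rw [List.cons_append, PlateSystem.fw_cons, PlateSystem.fw_cons, ih]

open scoped Classical in
/-- **Pulling a typed end-pair export of the mirrored cell back to the cell.**  See the module docstring. -/
theorem endPairs_pullback_mirror (ver : WordVersion) (X : Finset (EuclideanSpace ℝ (Fin 3))) (c : EuclideanSpace ℝ (Fin 3))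
    (hc : basalMirror c = -c) (L G : EuclideanSpace ℝ (Fin 3) ≃ₗᵢ[ℝ] EuclideanSpace ℝ (Fin 3))
    (hG : G = ((((ℝ ∙ EuclideanSpace.single (2 : Fin 3) (1 : ℝ)).reflection).trans L).trans basalMirror))
    (T' : Finset (EuclideanSpace ℝ (Fin 3) × EuclideanSpace ℝ (Fin 3))) {lo hi : ℝ}
    (hTpair' : ∀ bq ∈ T', bq.1 ∈ X.image (fun p => basalMirror p + c) ∧ bq.2 ∈ X.image (fun p => basalMirror p + c) ∧
      dist bq.1 bq.2 = 1 ∧ lo ≤ bq.1 2 ∧ bq.1 2 < hi)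
    (hTpay' : ∀ bq ∈ T', ((X.image (fun p => basalMirror p + c)).filter fun q => dist bq.1 q = 1).card ≤ 11 ∨
      ∃ z₁ ∈ X.image (fun p => basalMirror p + c), ∃ z₂ ∈ X.image (fun p => basalMirror p + c), z₁ ≠ z₂ ∧
        dist bq.1 z₁ = 1 ∧ dist bq.1 z₂ = 1 ∧
        ((X.image (fun p => basalMirror p + c)).filter fun q => dist z₁ q = 1).card ≤ 11 ∧
        ((X.image (fun p => basalMirror p + c)).filter fun q => dist z₂ q = 1).card ≤ 11)
    (hTwit' : ∀ bq ∈ T', ∃ r ∈ inPlaneRoots G 1, ∃ κ : List (EuclideanSpace ℝ (Fin 3)), WFChain r κ ∧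
      bq.2 - (⟨G, inPlaneRoots G 1⟩ : PlateSystem).Fw κ (((-1 : ℝ) ^ κ.length) • r) ∈ X.image (fun p => basalMirror p + c) ∧
      IsEndMove (X.image (fun p => basalMirror p + c)) ver ((⟨G, inPlaneRoots G 1⟩ : PlateSystem).Fw κ)
        ((⟨G, inPlaneRoots G 1⟩ : PlateSystem).Fw κ (((-1 : ℝ) ^ κ.length) • r)) bq.2 bq.1) :
    ∃ T : Finset (EuclideanSpace ℝ (Fin 3) × EuclideanSpace ℝ (Fin 3)), T.card = T'.card ∧
      (∀ bq ∈ T, bq.1 ∈ X ∧ bq.2 ∈ X ∧ dist bq.1 bq.2 = 1 ∧ c 2 - hi < bq.1 2 ∧ bq.1 2 ≤ c 2 - lo) ∧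
      (∀ bq ∈ T, (X.filter fun q => dist bq.1 q = 1).card ≤ 11 ∨
        ∃ z₁ ∈ X, ∃ z₂ ∈ X, z₁ ≠ z₂ ∧ dist bq.1 z₁ = 1 ∧ dist bq.1 z₂ = 1 ∧
          (X.filter fun q => dist z₁ q = 1).card ≤ 11 ∧ (X.filter fun q => dist z₂ q = 1).card ≤ 11) ∧
      (∀ bq ∈ T, ∃ r ∈ inPlaneRoots L 1, ∃ κ : List (EuclideanSpace ℝ (Fin 3)),
        (∀ μ ∈ κ, ‖μ‖ = 1 ∧
          ∀ w ∈ fccSlots, ⟪w, μ⟫_ℝ = 0 ∨ ⟪w, μ⟫_ℝ = Real.sqrt (2 / 3) ∨ ⟪w, μ⟫_ℝ = -Real.sqrt (2 / 3)) ∧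
        (∀ μ ∈ κ, ⟪r, μ⟫_ℝ = Real.sqrt (2 / 3) ∨ ⟪r, μ⟫_ℝ = -Real.sqrt (2 / 3)) ∧
        List.IsChain (fun μ μ' => ⟪μ, μ'⟫_ℝ = 1 / 3 ∨ ⟪μ, μ'⟫_ℝ = -1 / 3) (κ ++ [EuclideanSpace.single (2 : Fin 3) (1 : ℝ)]) ∧
        (bq.1 = bq.2 + (⟨L, inPlaneRoots L 1⟩ : PlateSystem).Fw (κ ++ [EuclideanSpace.single (2 : Fin 3) (1 : ℝ)])
            (((-1 : ℝ) ^ (κ ++ [EuclideanSpace.single (2 : Fin 3) (1 : ℝ)]).length) • r) ∨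
          ∃ m : EuclideanSpace ℝ (Fin 3), ‖m‖ = 1 ∧
            (∀ w ∈ fccSlots,
              ⟪(⟨L, inPlaneRoots L 1⟩ : PlateSystem).Fw (κ ++ [EuclideanSpace.single (2 : Fin 3) (1 : ℝ)]) w, m⟫_ℝ = 0 ∨
              ⟪(⟨L, inPlaneRoots L 1⟩ : PlateSystem).Fw (κ ++ [EuclideanSpace.single (2 : Fin 3) (1 : ℝ)]) w, m⟫_ℝ =
                Real.sqrt (2 / 3) ∨
              ⟪(⟨L, inPlaneRoots L 1⟩ : PlateSystem).Fw (κ ++ [EuclideanSpace.single (2 : Fin 3) (1 : ℝ)]) w, m⟫_ℝ =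
                -Real.sqrt (2 / 3)) ∧
            ⟪(⟨L, inPlaneRoots L 1⟩ : PlateSystem).Fw (κ ++ [EuclideanSpace.single (2 : Fin 3) (1 : ℝ)])
              (((-1 : ℝ) ^ (κ ++ [EuclideanSpace.single (2 : Fin 3) (1 : ℝ)]).length) • r), m⟫_ℝ = Real.sqrt (2 / 3) ∧
            bq.1 = bq.2 - ((⟨L, inPlaneRoots L 1⟩ : PlateSystem).Fw (κ ++ [EuclideanSpace.single (2 : Fin 3) (1 : ℝ)])
              (((-1 : ℝ) ^ (κ ++ [EuclideanSpace.single (2 : Fin 3) (1 : ℝ)]).length) • r) -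
              (2 * ⟪(⟨L, inPlaneRoots L 1⟩ : PlateSystem).Fw (κ ++ [EuclideanSpace.single (2 : Fin 3) (1 : ℝ)])
                (((-1 : ℝ) ^ (κ ++ [EuclideanSpace.single (2 : Fin 3) (1 : ℝ)]).length) • r), m⟫_ℝ) • m))) ∧
      (∀ bq ∈ T, ∃ (G' : EuclideanSpace ℝ (Fin 3) ≃ₗᵢ[ℝ] EuclideanSpace ℝ (Fin 3)) (d' : EuclideanSpace ℝ (Fin 3)),
        PlateSystem.Adm ⟨((ℝ ∙ EuclideanSpace.single (2 : Fin 3) (1 : ℝ)).reflection).trans L,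
          inPlaneRoots (((ℝ ∙ EuclideanSpace.single (2 : Fin 3) (1 : ℝ)).reflection).trans L) (-1)⟩ G' d' ∧
        bq.2 - d' ∈ X ∧ IsEndMove X ver G' d' bq.2 bq.1) := by
  set e₃ : EuclideanSpace ℝ (Fin 3) := EuclideanSpace.single (2 : Fin 3) (1 : ℝ) with he₃
  set H : EuclideanSpace ℝ (Fin 3) ≃ₗᵢ[ℝ] EuclideanSpace ℝ (Fin 3) := (ℝ ∙ e₃).reflection with hH
  have he₃1 : ‖e₃‖ = 1 := by rw [he₃, PiLp.norm_single, norm_one]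
  -- the cell mirror `M`
  set M : EuclideanSpace ℝ (Fin 3) → EuclideanSpace ℝ (Fin 3) := fun p => basalMirror p + c with hM
  set X' := X.image M with hX'
  have hMM : ∀ p, M (M p) = p := by
    intro p; simp only [hM, map_add, basalMirror_basalMirror, hc]; abel
  have hMinj : Function.Injective M := fun p q hpq => by
    have := congrArg M hpq; rwa [hMM, hMM] at this
  have hMdist : ∀ p q, dist (M p) (M q) = dist p q := by
    intro p q; simp only [hM, dist_add_right, LinearIsometryEquiv.dist_map]
  have hc0 : c 0 = 0 := by
    have h := congrArg (fun v : EuclideanSpace ℝ (Fin 3) => v 0) hc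
    simp only [basalMirror_apply_coord, PiLp.neg_apply] at h
    have : (0 : Fin 3) ≠ 2 := by decide
    rw [if_neg this] at h; linarith
  have hc1 : c 1 = 0 := by
    have h := congrArg (fun v : EuclideanSpace ℝ (Fin 3) => v 1) hc
    simp only [basalMirror_apply_coord, PiLp.neg_apply] at h
    have : (1 : Fin 3) ≠ 2 := by decide
    rw [if_neg this] at h; linarith
  have hM2 : ∀ p, M p 2 = c 2 - p 2 := by
    intro p; simp only [hM, PiLp.add_apply, basalMirror_apply_coord, if_true]; ring
  have hmemX' : ∀ p, p ∈ X' ↔ M p ∈ X := by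
    intro p
    constructor
    · intro hp
      obtain ⟨q, hq, rfl⟩ := mem_image.1 hp
      rw [hMM]; exact hq
    · intro hp
      exact mem_image.2 ⟨M p, hp, hMM p⟩
  have hX'' : X'.image M = X := by
    ext p
    rw [mem_image]
    constructor
    · rintro ⟨q, hq, rfl⟩; exact (hmemX' q).1 hq
    · intro hp; exact ⟨M p, (hmemX' _).2 (by rw [hMM]; exact hp), hMM p⟩
  have hdeg : ∀ b, (X'.filter fun q => dist b q = 1).card = (X.filter fun q => dist (M b) q = 1).card := by
    intro b
    have : (X.filter fun q => dist (M b) q = 1) = (X'.filter fun q => dist b q = 1).image M := by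
      ext q
      rw [mem_filter, mem_image]
      constructor
      · rintro ⟨hq, hd⟩
        refine ⟨M q, mem_filter.2 ⟨(hmemX' _).2 (by rw [hMM]; exact hq), ?_⟩, hMM q⟩
        rw [← hMdist, hMM]; exact hd
      · rintro ⟨q', hq', rfl⟩
        obtain ⟨hq'X, hd⟩ := mem_filter.1 hq'
        exact ⟨(hmemX' q').1 hq'X, by rw [hMdist]; exact hd⟩
    rw [this, card_image_of_injective _ hMinj]
  -- the half-turn on horizontal vectors, and the root sets
  have hHneg : ∀ r : EuclideanSpace ℝ (Fin 3), r 2 = 0 → H r = -r := by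
    intro r hr; rw [hH, halfTurn_apply, hr, mul_zero, zero_smul, zero_sub]
  have hbM2 : ∀ v : EuclideanSpace ℝ (Fin 3), basalMirror v 2 = -v 2 := fun v => by
    rw [basalMirror_apply_coord, if_pos rfl]
  have hG2 : ∀ r : EuclideanSpace ℝ (Fin 3), r 2 = 0 → G r 2 = L r 2 := by
    intro r hr
    rw [hG, LinearIsometryEquiv.trans_apply, LinearIsometryEquiv.trans_apply, hbM2, hHneg r hr, map_neg,
      PiLp.neg_apply, neg_neg]
  have hRT : inPlaneRoots G 1 = inPlaneRoots L 1 := by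
    unfold inPlaneRoots
    refine filter_congr fun r _ => ?_
    constructor
    · rintro ⟨h0, h1⟩; exact ⟨h0, by rw [← hG2 r h0]; exact h1⟩
    · rintro ⟨h0, h1⟩; exact ⟨h0, by rw [hG2 r h0]; exact h1⟩
  have hRT₂ : inPlaneRoots (H.trans L) (-1) = inPlaneRoots L 1 := by
    unfold inPlaneRoots
    refine filter_congr fun r _ => ?_
    have key : r 2 = 0 → (H.trans L) r 2 = -(L r 2) := by
      intro hr; rw [LinearIsometryEquiv.trans_apply, hHneg r hr, map_neg, PiLp.neg_apply]
    constructor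
    · rintro ⟨h0, h1⟩; refine ⟨h0, ?_⟩; rw [key h0] at h1; linarith
    · rintro ⟨h0, h1⟩; refine ⟨h0, ?_⟩; rw [key h0]; linarith
  -- the frames: `basalMirror ∘ Fw_G κ = Fw_{H ≫ L} κ = − Fw_L (κ ++ [e₃])`
  set SG : PlateSystem := ⟨G, inPlaneRoots G 1⟩ with hSG
  set S₁ : PlateSystem := ⟨L, inPlaneRoots L 1⟩ with hS₁
  set S₂ : PlateSystem := ⟨H.trans L, inPlaneRoots (H.trans L) (-1)⟩ with hS₂
  have hconv₂ : ∀ κ : List (EuclideanSpace ℝ (Fin 3)), (SG.Fw κ).trans basalMirror = S₂.Fw κ := by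
    intro κ
    induction κ with
    | nil =>
      refine LinearIsometryEquiv.ext fun x => ?_
      show basalMirror (G x) = (H.trans L) x
      rw [hG, LinearIsometryEquiv.trans_apply, basalMirror_basalMirror]
    | cons μ κ ih =>
      rw [PlateSystem.fw_cons, PlateSystem.fw_cons, ← ih]; rfl
  have hconv₁ : ∀ (κ : List (EuclideanSpace ℝ (Fin 3))) (x : EuclideanSpace ℝ (Fin 3)),
      S₂.Fw κ x = -S₁.Fw (κ ++ [e₃]) x := by
    intro κ x
    rw [PlateSystem.fw_append_e₃ L (inPlaneRoots L 1) (inPlaneRoots (H.trans L) (-1)) κ]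
    -- both are word frames over base frames that differ by a sign: `H ≫ L = −(M_{e₃} ≫ L)`
    induction κ generalizing x with
    | nil =>
      show (H.trans L) x = -((basalMirror.trans L) x)
      rw [LinearIsometryEquiv.trans_apply, LinearIsometryEquiv.trans_apply, ← map_neg]
      congr 1
      rw [hH, halfTurn_apply, basalMirror, reflection_unit_apply he₃1, ← apply_two_eq_inner_e₃]
      module
    | cons μ κ ih =>
      rw [PlateSystem.fw_cons, PlateSystem.fw_cons, LinearIsometryEquiv.trans_apply, LinearIsometryEquiv.trans_apply, ih]
  -- the pulled-back pair set
  set T : Finset (EuclideanSpace ℝ (Fin 3) × EuclideanSpace ℝ (Fin 3)) := T'.image (fun bq => (M bq.1, M bq.2)) with hT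
  have hPinj : Function.Injective (fun bq : EuclideanSpace ℝ (Fin 3) × EuclideanSpace ℝ (Fin 3) => (M bq.1, M bq.2)) := by
    intro a b hab
    simp only [Prod.mk.injEq] at hab
    exact Prod.ext (hMinj hab.1) (hMinj hab.2)
  refine ⟨T, card_image_of_injective _ hPinj, ?_, ?_, ?_, ?_⟩
  · -- balls, contact, reflected window
    intro bq hbq
    obtain ⟨bq', hbq', rfl⟩ := mem_image.1 hbq
    obtain ⟨h1, h2, h3, h4, h5⟩ := hTpair' bq' hbq'
    refine ⟨(hmemX' _).1 h1, (hmemX' _).1 h2, by rw [hMdist]; exact h3, ?_, ?_⟩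
    · show c 2 - hi < M bq'.1 2; rw [hM2]; linarith
    · show M bq'.1 2 ≤ c 2 - lo; rw [hM2]; linarith
  · -- two payers (degrees are `M`-invariant)
    intro bq hbq
    obtain ⟨bq', hbq', rfl⟩ := mem_image.1 hbq
    rcases hTpay' bq' hbq' with h11 | ⟨z₁, hz₁, z₂, hz₂, hne, hd₁, hd₂, hc₁, hc₂⟩
    · left; show (X.filter fun q => dist (M bq'.1) q = 1).card ≤ 11; rw [← hdeg]; exact h11
    · right
      refine ⟨M z₁, (hmemX' _).1 hz₁, M z₂, (hmemX' _).1 hz₂, fun h' => hne (hMinj h'), ?_, ?_, ?_, ?_⟩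
      · show dist (M bq'.1) (M z₁) = 1; rw [hMdist]; exact hd₁
      · show dist (M bq'.1) (M z₂) = 1; rw [hMdist]; exact hd₂
      · rw [← hdeg]; exact hc₁
      · rw [← hdeg]; exact hc₂
  · -- the SHAPE form over the bottom frame `L`
    intro bq hbq
    obtain ⟨bq', hbq', rfl⟩ := mem_image.1 hbq
    obtain ⟨r, hr, κ, hWF, -, hmove⟩ := hTwit' bq' hbq'
    rw [hRT] at hr
    have hr2 : r 2 = 0 := (mem_filter.1 hr).2.1
    obtain ⟨hlet, hch⟩ := wfChain_letters hWF
    have hob := wfChain_oblique hWF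
    -- transport the end-move to `X`
    have hmoveX := isEndMove_transport (X' := X') basalMirror c hmove
    rw [hX'', hconv₂ κ] at hmoveX
    set d : EuclideanSpace ℝ (Fin 3) := SG.Fw κ (((-1 : ℝ) ^ κ.length) • r) with hd
    set κ'' := κ ++ [e₃] with hκ''
    have hd' : basalMirror d = S₁.Fw κ'' (((-1 : ℝ) ^ κ''.length) • r) := by
      have e1 : basalMirror d = S₂.Fw κ (((-1 : ℝ) ^ κ.length) • r) := by
        rw [hd, ← hconv₂ κ]; rfl
      rw [e1, hconv₁, hκ'', List.length_append, List.length_singleton, pow_succ, ← map_neg]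
      congr 1; module
    refine ⟨r, hr, κ, hlet, hob, ?_, ?_⟩
    · -- the appended chain
      rw [List.isChain_append]
      refine ⟨hch, List.isChain_singleton _, ?_⟩
      intro x hx y hy
      rw [List.head?_cons, Option.mem_some_iff] at hy
      subst hy
      obtain ⟨l, hl⟩ : ∃ l, κ = l ++ [x] := by
        rcases List.eq_nil_or_concat' κ with h0 | ⟨l, a, h0⟩
        · rw [h0] at hx; simp at hx
        · refine ⟨l, ?_⟩
          rw [h0, List.getLast?_concat, Option.mem_some_iff] at hx
          rw [h0, hx]
      have hxκ : x ∈ κ := by rw [hl]; simp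
      obtain ⟨hx1, hxm⟩ := hlet x hxκ
      obtain ⟨hxe, hxe'⟩ := wfChain_letter_ne_axis hr2 hWF hxκ
      exact menuNormals_chain_of_ne_of_ne_neg hx1 he₃1 hxm
        (fun w hw => by rw [← apply_two_eq_inner_e₃]; exact slot_apply_two_cases hw) hxe
        (fun h' => hxe' (by rw [← he₃]; rw [h', neg_neg]))
    · -- the shape of the move, read in `X`
      rcases shape_of_isEndMove hmoveX with hstraight | ⟨m, hm1, hmenu, hdm, hcross⟩
      · left
        show M bq'.1 = M bq'.2 + _
        rw [← hd']; exact hstraight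
      · right
        refine ⟨m, hm1, fun w hw => ?_, by rw [← hd']; exact hdm, by
          show M bq'.1 = M bq'.2 - _; rw [← hd']; exact hcross⟩
        have key := hmenu w hw
        rw [hconv₁ κ w, inner_neg_left] at key
        rcases key with h0 | h0 | h0
        · left; linarith
        · right; right; linarith
        · right; left; linarith
  · -- the ADMISSIBLE-CLASS form for the top system of the twin row
    intro bq hbq
    obtain ⟨bq', hbq', rfl⟩ := mem_image.1 hbq
    obtain ⟨r, hr, κ, hWF, hpred, hmove⟩ := hTwit' bq' hbq'
    have hmoveX := isEndMove_transport (X' := X') basalMirror c hmove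
    rw [hX'', hconv₂ κ] at hmoveX
    set d : EuclideanSpace ℝ (Fin 3) := SG.Fw κ (((-1 : ℝ) ^ κ.length) • r) with hd
    have hd₂ : basalMirror d = S₂.Fw κ (((-1 : ℝ) ^ κ.length) • r) := by rw [hd, ← hconv₂ κ]; rfl
    refine ⟨S₂.Fw κ, S₂.Fw κ (((-1 : ℝ) ^ κ.length) • r),
      ⟨r, by show r ∈ inPlaneRoots (H.trans L) (-1); rw [hRT₂, ← hRT]; exact hr, κ, hWF, rfl, rfl⟩, ?_, ?_⟩
    · -- the predecessor ball
      have := (hmemX' _).1 hpred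
      have e : M (bq'.2 - d) = M bq'.2 - basalMirror d := by
        simp only [hM, map_sub]; abel
      rw [e, hd₂] at this
      exact this
    · rw [← hd₂]; exact hmoveX

end Summit.Ventures.Crystal3D.Theorems

end
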